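import Summits.BirchSwinnertonDyer.Rank1Residual.X4.KimShaLengthFiveLeEndState
import Summits.BirchSwinnertonDyer.Rank1Residual.X4.OptimalPeriod
import Summits.BirchSwinnertonDyer.Rank1Residual.Additive.QuadraticTwistBSDComparisonIsogeny
import HarnessLib

/-!
# Kim's Conjecture 1.10 in analytic rank 0 at `p ≥ 5` is an ISOGENY INVARIANT; the OPTIMAL-datum form
# of the `p ≥ 5` iffs (period transfer discharged by optimality); the X4 ∧ r0 END STATE at `p ≥ 5`
# over OPTIMAL curves with the honest MANIN♭ residue (cell `b2b-bsdres`, seat additive-p4 gen 17,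
# line V32; CLASS-CLOSURE §3.2 E3 "transport search — isogeny (Cassels)" for the N10 ∩ X4 block)

HONEST FRAMING (cell `b2b-bsdres`, run/shared/lean/b2b/bsd-rank1-residual/, verbatim in every
file): the goal of the cell is to DELETE the COMBINATION-SHAPED residual classes of the
Birch–Swinnerton-Dyer formula for ALL analytic-rank `≤ 1` elliptic curves over `ℚ` — "full BSD
formula for every rank `≤ 1` curve in class `C`" assembled STRICTLY from published theorems — so
that the rank-`≤ 1` remainder becomes exactly the CONSTRUCTION-SHAPED classes, which are TYPED
(missing-input `Prop`s), NOT attempted. This is not "finishing BSD". Sub-cell additive-p4 (X3♯/X4♯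
direct): research route on the CONSTRUCTION-SHAPED class X4; the label X4 and the marks of
RESIDUAL-MAP §I N10/N11 are UNCHANGED; nothing is booked. Theorems only (no definition, no named
fact minted). Published inputs are explicit named-fact HYPOTHESES: `hKimk` (n1011-p11 p249207, flag
`Kim-(6)-partial-reading`), `hE67c` (harvest-2 p250376, flag `Kim2026-(6)-cyclic-reading`), Cassels'
isogeny invariance `hCassels = bsdRHS_eq_of_isIsogenous`, GZK `hGZK`, modularity `hmod`. Kim's
Conjecture 1.10 appears only as n1011-p12's typed PREDICATE `X4.KimTamagawaDefectAt` — never assumed.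

## What this file proves

* §1 **E3 transport (isogeny)**: `kimTamagawaDefectAt_iff_of_isIsogenous_of_kimFacts_of_five_le` —
  for `ℚ`-isogenous globally minimal `W ∼ W'` in analytic rank `0`, `p ≥ 5` surjective for both, each
  with a conductor-level datum (`p ∤ c_D`, period transfer), Kim's Conjecture 1.10 holds at
  `(W, p, D.f)` iff it holds at `(W', p, D'.f)`; likewise for each half (`…LeAt`, `…GeAt`); and
  `kimTamagawaDefectAt_of_bsdp_isogenous_…`: `BSD(W', p)` for ANY isogenous `W'` (closed by any
  route, no datum on `W'`) gives the conjecture at `(W, p, D.f)`. Inputs: the sibling's iffs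
  (`X4/KimShaLengthFiveLe.lean`) and the cell's kernel form of Cassels' theorem
  (`Additive.TwistComparison.bsdp_iff_bsdp_of_isIsogenous`, `missing{Lower,Upper}BoundAt_of_isIsogenous`).
  Consequence for the census (E1/E4): test / calibrate Conjecture 1.10 on ONE curve per isogeny class.
* §2 **OPTIMAL data**: on an optimal parametrisation datum `D` (`Λ_E = c·Λ_f`, additive-p3's
  `X4.periodTransfer_of_optimal`) with `p ∤ c` the period-transfer binder is DISCHARGED:
  `kimShaLengthRankZeroAt_of_optimal_…`, `missingPPartAt_iff_kimTamagawaDefectAt_of_optimal_…`,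
  `bsdp_iff_kimTamagawaDefectAt_of_optimal_…` — binders: `p ≥ 5`, `r_an = 0`, surj, optimal
  conductor-level `D`, `p ∤ c`.
* §3 **the X4 ∧ `r_an = 0` END STATE at `p ≥ 5` over OPTIMAL curves, MANIN♭ made honest**:
  `x4RankZero_fiveLe_iff_kimTamagawaDefect_optimal_of_kimFacts` — "MissingPPartAt on every X4 ∧ r0 ∧
  surj ∧ `p ≥ 5` pair" ⟺ (i) Kim's Conjecture 1.10 on every such pair for every OPTIMAL conductor-level
  datum with `p ∤ c` ∧ (ii) MissingPPartAt on the pairs `(W, p)` such that NO X4 ∧ surj curve `W₀`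
  isogenous to `W` carries an optimal conductor-level datum with `p ∤ c` — the MANIN♭ residue proper
  (for the strong Weil curve of the class: `p ∣ c_Manin`; conjecturally empty, Agashe–Ribet–Stein),
  every other class being reached from its optimal member by Cassels' isogeny invariance.

Nothing here closes a class; X4 stays CONSTRUCTION-SHAPED; no mark moves; nothing is booked.

References: Kim 2026 [Kim2022StructureSelmer] Thm. 1.9 (6), Conj. 1.10, §1.3.5; Cassels 1965
[Cassels1965ArithmeticVIII]; Miller 2011 [Miller2011LMS] §1, Def. 1.1; Agashe–Ribet–Stein 2006
[AgasheRibetStein2006] Thm. 2.6; Cremona, *Algorithms* §2.8 [CremonaAlgorithms1997];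
CLASS-CLOSURE-PLAN.md §1 item 5 (E3), §3.2.
-/

noncomputable section

open scoped Classical MatrixGroups ModularForm

open Complex CongruenceSubgroup WeierstrassCurve Literature.NumberTheory.EllipticCurves
  Literature.NumberTheory.EllipticCurves.ModularForms
  Literature.NumberTheory.EllipticCurves.Rank1Residual
  Literature.NumberTheory.EllipticCurves.Rank1Residual.Typed

namespace Summit.BirchSwinnertonDyer.Rank1Residual.X4

/-! ### §1 Conjecture 1.10 (rank 0, `p ≥ 5`) is an isogeny invariant -/

section Isogeny

variable (W W' : WeierstrassCurve ℚ) [W.IsElliptic] [W.IsGloballyMinimal] [W'.IsElliptic]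
  [W'.IsGloballyMinimal] (p : ℕ) [Fact p.Prime]

/-- **Kim's Conjecture 1.10 at `p ≥ 5` in analytic rank `0` is an ISOGENY INVARIANT** (granted
admissible conductor-level data on both sides): for `ℚ`-isogenous globally minimal `W ∼ W'` with
`ord_{s=1} L(W,s) = 0`, `ρ̄_{W,p}` and `ρ̄_{W',p}` onto, data `D`, `D'` at the conductor levels with
`p ∤ c_D`, `p ∤ c_{D'}` and the period transfers, `∂^{(∞)}(δ̃_{D.f}) = ord_p ∏_v c_v(W)` iff
`∂^{(∞)}(δ̃_{D'.f}) = ord_p ∏_v c_v(W')`. Route: both sides are `BSD(·,p)` by the sibling's iff, and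
`BSD(E,p)` is an isogeny invariant (Cassels, kernel form `TwistComparison.bsdp_iff_bsdp_of_isIsogenous`).
[cite: Kim2022StructureSelmer, Thm. 1.9 (6) and Conj. 1.10 (PDF p. 8)] [cite: Cassels1965ArithmeticVIII]
[cite: Miller2011LMS, §1 and Def. 1.1] -/
theorem kimTamagawaDefectAt_iff_of_isIsogenous_of_kimFacts_of_five_le
    (hKimk : Kim2026.rankZero_le_padicValNat_sha_of_kuriharaNumber_ne_zero)
    (hE67c : Kim2026.rankZero_padicValNat_sha_add_le_of_forall_pow_dvd_kuriharaNumber_cyclicLevel)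
    (hCassels : bsdRHS_eq_of_isIsogenous)
    (hGZK : rank_eq_analyticRank_of_analyticRank_le_one) (hmod : hasEntireLFunction_rat)
    (hiso : IsIsogenous W W') (hp : 5 ≤ p) (hr : W.analyticRank = 0)
    (hsurj : W.HasSurjectiveModNGaloisRep p) (hsurj' : W'.HasSurjectiveModNGaloisRep p)
    {N : ℕ} [NeZero N] (D : ModularParametrizationData W N) (hN : W.conductorNorm ℤ = N)
    (hc : ¬ (p : ℤ) ∣ D.maninConstant)
    (hper : ∃ u : ℚ, ‖(u : ℚ_[p])‖ = 1 ∧ W.realPeriodRat = u * plusPeriod D.f)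
    {N' : ℕ} [NeZero N'] (D' : ModularParametrizationData W' N') (hN' : W'.conductorNorm ℤ = N')
    (hc' : ¬ (p : ℤ) ∣ D'.maninConstant)
    (hper' : ∃ u : ℚ, ‖(u : ℚ_[p])‖ = 1 ∧ W'.realPeriodRat = u * plusPeriod D'.f) :
    KimTamagawaDefectAt W p D.f ↔ KimTamagawaDefectAt W' p D'.f := by
  have hr' : W'.analyticRank = 0 := by rw [← analyticRank_eq_of_isIsogenous' hiso]; exact hr
  rw [← bsdp_iff_kimTamagawaDefectAt_of_kimFacts_of_five_le W p hKimk hE67c hGZK hmod hp hr hsurj D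
      hN hc hper,
    ← bsdp_iff_kimTamagawaDefectAt_of_kimFacts_of_five_le W' p hKimk hE67c hGZK hmod hp hr' hsurj' D'
      hN' hc' hper']
  exact Additive.TwistComparison.bsdp_iff_bsdp_of_isIsogenous W W' p hCassels hGZK hmod hiso
    (by rw [hr]; exact zero_le_one)

/-- **The `≤` half is an isogeny invariant too** (rank `0`, `p ≥ 5`, data on both sides): via the
sibling's `MissingLowerBoundAt ⟺ …LeAt` and `TwistComparison.missingLowerBoundAt_of_isIsogenous`.
[cite: Kim2022StructureSelmer, Conj. 1.10 (PDF p. 8)] [cite: Cassels1965ArithmeticVIII] [cite: Miller2011LMS, Def. 1.1] -/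
theorem kimTamagawaDefectLeAt_iff_of_isIsogenous_of_kimFacts_of_five_le
    (hKimk : Kim2026.rankZero_le_padicValNat_sha_of_kuriharaNumber_ne_zero)
    (hE67c : Kim2026.rankZero_padicValNat_sha_add_le_of_forall_pow_dvd_kuriharaNumber_cyclicLevel)
    (hCassels : bsdRHS_eq_of_isIsogenous)
    (hGZK : rank_eq_analyticRank_of_analyticRank_le_one) (hmod : hasEntireLFunction_rat)
    (hiso : IsIsogenous W W') (hp : 5 ≤ p) (hr : W.analyticRank = 0)
    (hsurj : W.HasSurjectiveModNGaloisRep p) (hsurj' : W'.HasSurjectiveModNGaloisRep p)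
    {N : ℕ} [NeZero N] (D : ModularParametrizationData W N) (hN : W.conductorNorm ℤ = N)
    (hc : ¬ (p : ℤ) ∣ D.maninConstant)
    (hper : ∃ u : ℚ, ‖(u : ℚ_[p])‖ = 1 ∧ W.realPeriodRat = u * plusPeriod D.f)
    {N' : ℕ} [NeZero N'] (D' : ModularParametrizationData W' N') (hN' : W'.conductorNorm ℤ = N')
    (hc' : ¬ (p : ℤ) ∣ D'.maninConstant)
    (hper' : ∃ u : ℚ, ‖(u : ℚ_[p])‖ = 1 ∧ W'.realPeriodRat = u * plusPeriod D'.f) :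
    KimTamagawaDefectLeAt W p D.f ↔ KimTamagawaDefectLeAt W' p D'.f := by
  have hrr : W.analyticRank = W'.analyticRank := analyticRank_eq_of_isIsogenous' hiso
  have hr' : W'.analyticRank = 0 := by rw [← hrr]; exact hr
  rw [← missingLowerBoundAt_iff_kimTamagawaDefectLeAt_of_kimFacts_of_five_le W p hKimk hE67c hGZK
      hmod hp hr hsurj D hN hc hper,
    ← missingLowerBoundAt_iff_kimTamagawaDefectLeAt_of_kimFacts_of_five_le W' p hKimk hE67c hGZK
      hmod hp hr' hsurj' D' hN' hc' hper']
  exact ⟨Additive.TwistComparison.missingLowerBoundAt_of_isIsogenous W W' p hCassels hGZK hmod hiso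
      (by rw [hr]; exact zero_le_one),
    Additive.TwistComparison.missingLowerBoundAt_of_isIsogenous W' W p hCassels hGZK hmod
      hiso.symm_of_isElliptic (by rw [hr']; exact zero_le_one)⟩

/-- **The `≥` half is an isogeny invariant too** (rank `0`, `p ≥ 5`, data on both sides).
[cite: Kim2022StructureSelmer, Conj. 1.10 (PDF p. 8)] [cite: Cassels1965ArithmeticVIII] [cite: Miller2011LMS, Def. 1.1] -/
theorem kimTamagawaDefectGeAt_iff_of_isIsogenous_of_kimFacts_of_five_le
    (hKimk : Kim2026.rankZero_le_padicValNat_sha_of_kuriharaNumber_ne_zero)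
    (hE67c : Kim2026.rankZero_padicValNat_sha_add_le_of_forall_pow_dvd_kuriharaNumber_cyclicLevel)
    (hCassels : bsdRHS_eq_of_isIsogenous)
    (hGZK : rank_eq_analyticRank_of_analyticRank_le_one) (hmod : hasEntireLFunction_rat)
    (hiso : IsIsogenous W W') (hp : 5 ≤ p) (hr : W.analyticRank = 0)
    (hsurj : W.HasSurjectiveModNGaloisRep p) (hsurj' : W'.HasSurjectiveModNGaloisRep p)
    {N : ℕ} [NeZero N] (D : ModularParametrizationData W N) (hN : W.conductorNorm ℤ = N)
    (hc : ¬ (p : ℤ) ∣ D.maninConstant)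
    (hper : ∃ u : ℚ, ‖(u : ℚ_[p])‖ = 1 ∧ W.realPeriodRat = u * plusPeriod D.f)
    {N' : ℕ} [NeZero N'] (D' : ModularParametrizationData W' N') (hN' : W'.conductorNorm ℤ = N')
    (hc' : ¬ (p : ℤ) ∣ D'.maninConstant)
    (hper' : ∃ u : ℚ, ‖(u : ℚ_[p])‖ = 1 ∧ W'.realPeriodRat = u * plusPeriod D'.f) :
    KimTamagawaDefectGeAt W p D.f ↔ KimTamagawaDefectGeAt W' p D'.f := by
  have hrr : W.analyticRank = W'.analyticRank := analyticRank_eq_of_isIsogenous' hiso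
  have hr' : W'.analyticRank = 0 := by rw [← hrr]; exact hr
  rw [← missingUpperBoundAt_iff_kimTamagawaDefectGeAt_of_kimFacts_of_five_le W p hKimk hE67c hGZK
      hmod hp hr hsurj D hN hc hper,
    ← missingUpperBoundAt_iff_kimTamagawaDefectGeAt_of_kimFacts_of_five_le W' p hKimk hE67c hGZK
      hmod hp hr' hsurj' D' hN' hc' hper']
  exact ⟨Additive.TwistComparison.missingUpperBoundAt_of_isIsogenous W W' p hCassels hGZK hmod hiso
      (by rw [hr]; exact zero_le_one),
    Additive.TwistComparison.missingUpperBoundAt_of_isIsogenous W' W p hCassels hGZK hmod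
      hiso.symm_of_isElliptic (by rw [hr']; exact zero_le_one)⟩

/-- **Transport from a CLOSED isogenous curve**: if `W'` is `ℚ`-isogenous to `W` and `BSD(W', p)` is
of record (by ANY route — certificate, twist transport, unit row; no datum needed on `W'`), then Kim's
Conjecture 1.10 holds at `(W, p, D.f)` for every admissible conductor-level datum `D` of `W`
(rank `0`, `p ≥ 5`, `ρ̄_{W,p}` onto). [cite: Kim2022StructureSelmer, Conj. 1.10 (PDF p. 8)]
[cite: Cassels1965ArithmeticVIII] [cite: Miller2011LMS, §1 and Def. 1.1] -/
theorem kimTamagawaDefectAt_of_bsdp_isogenous_of_kimFacts_of_five_le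
    (hKimk : Kim2026.rankZero_le_padicValNat_sha_of_kuriharaNumber_ne_zero)
    (hE67c : Kim2026.rankZero_padicValNat_sha_add_le_of_forall_pow_dvd_kuriharaNumber_cyclicLevel)
    (hCassels : bsdRHS_eq_of_isIsogenous)
    (hGZK : rank_eq_analyticRank_of_analyticRank_le_one) (hmod : hasEntireLFunction_rat)
    (hiso : IsIsogenous W' W) (hp : 5 ≤ p) (hr : W.analyticRank = 0)
    (hsurj : W.HasSurjectiveModNGaloisRep p)
    {N : ℕ} [NeZero N] (D : ModularParametrizationData W N) (hN : W.conductorNorm ℤ = N)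
    (hc : ¬ (p : ℤ) ∣ D.maninConstant)
    (hper : ∃ u : ℚ, ‖(u : ℚ_[p])‖ = 1 ∧ W.realPeriodRat = u * plusPeriod D.f)
    (h' : BSDp W' p) : KimTamagawaDefectAt W p D.f := by
  have hr' : W'.analyticRank ≤ 1 := by
    rw [analyticRank_eq_of_isIsogenous' hiso, hr]; exact zero_le_one
  exact (bsdp_iff_kimTamagawaDefectAt_of_kimFacts_of_five_le W p hKimk hE67c hGZK hmod hp hr hsurj D
    hN hc hper).mp
    (Additive.TwistComparison.bsdp_of_bsdp_of_isIsogenous W' W p hCassels hGZK hmod hiso hr' h')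

end Isogeny

/-! ### §2 OPTIMAL data: the period transfer discharged by optimality -/

section Optimal

variable (W : WeierstrassCurve ℚ) [W.IsElliptic] [W.IsGloballyMinimal] (p : ℕ) [Fact p.Prime]

/-- **Clause (6) at `p ≥ 5` on an OPTIMAL datum**: for an optimal parametrisation datum `D` at the
conductor level (`Λ_E = c·Λ_f`) with `p ∤ c`, `ρ̄` onto, `L(E,1) ≠ 0`, `Ш` finite:
`X4.KimShaLengthRankZeroAt W p D.f` — the period transfer supplied by `periodTransfer_of_optimal`
(`u = |c|`). [cite: Kim2022StructureSelmer, Thm. 1.9 (6) (PDF p. 8), §1.3.5 (PDF p. 6)]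
[cite: CremonaAlgorithms1997, §2.8 (p. 26)] -/
theorem kimShaLengthRankZeroAt_of_optimal_of_kimFacts_of_five_le
    (hKimk : Kim2026.rankZero_le_padicValNat_sha_of_kuriharaNumber_ne_zero)
    (hE67c : Kim2026.rankZero_padicValNat_sha_add_le_of_forall_pow_dvd_kuriharaNumber_cyclicLevel)
    (hp : 5 ≤ p) (hsurj : W.HasSurjectiveModNGaloisRep p) (hL : W.entireLFunction 1 ≠ 0)
    (hfin : Finite W.sha) {N : ℕ} [NeZero N] (D : ModularParametrizationData W N)
    (hN : W.conductorNorm ℤ = N)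
    (hopt : ∀ z ∈ D.L.lattice, ∃ w ∈ periodLattice D.f, z = D.c * w)
    (hc : ¬ (p : ℤ) ∣ D.maninConstant) :
    KimShaLengthRankZeroAt W p D.f :=
  kimShaLengthRankZeroAt_of_kimFacts_of_five_le W p hKimk hE67c hp hsurj hL hfin D hc
    (periodTransfer_of_optimal p D hopt hc) hN

/-- **`Typed.MissingPPartAt W p ⟺ X4.KimTamagawaDefectAt W p D.f` on an OPTIMAL conductor-level
datum with `p ∤ c`** (rank `0`, `p ≥ 5`, `ρ̄` onto; GZK, modularity). Binders: optimality + `p ∤ c`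
only — no separate period-transfer hypothesis. [cite: Kim2022StructureSelmer, Conj. 1.10 (PDF p. 8), §1.3.5]
[cite: Miller2011LMS, Def. 1.1] -/
theorem missingPPartAt_iff_kimTamagawaDefectAt_of_optimal_of_kimFacts_of_five_le
    (hKimk : Kim2026.rankZero_le_padicValNat_sha_of_kuriharaNumber_ne_zero)
    (hE67c : Kim2026.rankZero_padicValNat_sha_add_le_of_forall_pow_dvd_kuriharaNumber_cyclicLevel)
    (hGZK : rank_eq_analyticRank_of_analyticRank_le_one) (hmod : hasEntireLFunction_rat)
    (hp : 5 ≤ p) (hr : W.analyticRank = 0) (hsurj : W.HasSurjectiveModNGaloisRep p)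
    {N : ℕ} [NeZero N] (D : ModularParametrizationData W N) (hN : W.conductorNorm ℤ = N)
    (hopt : ∀ z ∈ D.L.lattice, ∃ w ∈ periodLattice D.f, z = D.c * w)
    (hc : ¬ (p : ℤ) ∣ D.maninConstant) :
    MissingPPartAt W p ↔ KimTamagawaDefectAt W p D.f :=
  missingPPartAt_iff_kimTamagawaDefectAt_of_kimFacts_of_five_le W p hKimk hE67c hGZK hmod hp hr hsurj D
    hN hc (periodTransfer_of_optimal p D hopt hc)

/-- **`BSD(E,p) ⟺ X4.KimTamagawaDefectAt W p D.f` on an OPTIMAL conductor-level datum with `p ∤ c`**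
(rank `0`, `p ≥ 5`, `ρ̄` onto). [cite: Kim2022StructureSelmer, Conj. 1.10 (PDF p. 8), §1.3.5]
[cite: Miller2011LMS, §1 and Def. 1.1] -/
theorem bsdp_iff_kimTamagawaDefectAt_of_optimal_of_kimFacts_of_five_le
    (hKimk : Kim2026.rankZero_le_padicValNat_sha_of_kuriharaNumber_ne_zero)
    (hE67c : Kim2026.rankZero_padicValNat_sha_add_le_of_forall_pow_dvd_kuriharaNumber_cyclicLevel)
    (hGZK : rank_eq_analyticRank_of_analyticRank_le_one) (hmod : hasEntireLFunction_rat)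
    (hp : 5 ≤ p) (hr : W.analyticRank = 0) (hsurj : W.HasSurjectiveModNGaloisRep p)
    {N : ℕ} [NeZero N] (D : ModularParametrizationData W N) (hN : W.conductorNorm ℤ = N)
    (hopt : ∀ z ∈ D.L.lattice, ∃ w ∈ periodLattice D.f, z = D.c * w)
    (hc : ¬ (p : ℤ) ∣ D.maninConstant) :
    BSDp W p ↔ KimTamagawaDefectAt W p D.f :=
  bsdp_iff_kimTamagawaDefectAt_of_kimFacts_of_five_le W p hKimk hE67c hGZK hmod hp hr hsurj D hN hc
    (periodTransfer_of_optimal p D hopt hc)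

end Optimal

/-! ### §3 The X4 ∧ `r_an = 0` END STATE at `p ≥ 5` over OPTIMAL curves; MANIN♭ made honest -/

/-- **X4 ∧ `r_an = 0` ∧ surj ∧ `p ≥ 5` END STATE over OPTIMAL curves, with the isogeny transport**
(inputs: the two Kim facts with their reading flags, Cassels `hCassels`, GZK, modularity — nothing
open assumed): "`MissingPPartAt` on every X4 ∧ `r_an = 0` ∧ surj(p) ∧ `p ≥ 5` pair" ⟺
(i) Kim's Conjecture 1.10 (`X4.KimTamagawaDefectAt W p D.f`) on every such pair for every OPTIMAL
conductor-level datum `D` with `p ∤ c` ∧ (ii) `MissingPPartAt W p` on the pairs `(W, p)` such that NO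
X4 ∧ surj(p) curve `W₀` that is `ℚ`-isogenous to `W` carries an optimal conductor-level datum with
`p ∤ c` — the MANIN♭ residue proper (the strong Weil curve of the class has `p ∣ c_Manin`, or admits
no optimal datum in the tree's sense); every other pair is reached from the optimal member of its
class by (i) and Cassels' isogeny invariance of `BSD(E,p)`. X4 stays CONSTRUCTION-SHAPED; no mark
moves; nothing booked. [cite: Kim2022StructureSelmer, Conj. 1.10 (PDF p. 8), §1.3.5 (PDF p. 6)]
[cite: Cassels1965ArithmeticVIII] [cite: AgasheRibetStein2006, Thm. 2.6] [cite: Miller2011LMS, §1 and Def. 1.1] -/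
theorem x4RankZero_fiveLe_iff_kimTamagawaDefect_optimal_of_kimFacts
    (hKimk : Kim2026.rankZero_le_padicValNat_sha_of_kuriharaNumber_ne_zero)
    (hE67c : Kim2026.rankZero_padicValNat_sha_add_le_of_forall_pow_dvd_kuriharaNumber_cyclicLevel)
    (hCassels : bsdRHS_eq_of_isIsogenous)
    (hGZK : rank_eq_analyticRank_of_analyticRank_le_one) (hmod : hasEntireLFunction_rat) :
    (∀ (W : WeierstrassCurve ℚ) [W.IsElliptic] [W.IsGloballyMinimal] (p : ℕ) [Fact p.Prime],
        5 ≤ p → W.analyticRank = 0 → ClassX4 W p → Surj W p → MissingPPartAt W p) ↔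
      (∀ (W : WeierstrassCurve ℚ) [W.IsElliptic] [W.IsGloballyMinimal] (p : ℕ) [Fact p.Prime],
          5 ≤ p → W.analyticRank = 0 → ClassX4 W p → Surj W p →
          ∀ {N : ℕ} [NeZero N] (D : ModularParametrizationData W N), W.conductorNorm ℤ = N →
          (∀ z ∈ D.L.lattice, ∃ w ∈ periodLattice D.f, z = D.c * w) → ¬ (p : ℤ) ∣ D.maninConstant →
          KimTamagawaDefectAt W p D.f) ∧
      (∀ (W : WeierstrassCurve ℚ) [W.IsElliptic] [W.IsGloballyMinimal] (p : ℕ) [Fact p.Prime],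
          5 ≤ p → W.analyticRank = 0 → ClassX4 W p → Surj W p →
          (∀ (W₀ : WeierstrassCurve ℚ) [W₀.IsElliptic] [W₀.IsGloballyMinimal],
            IsIsogenous W₀ W → ClassX4 W₀ p → Surj W₀ p →
            ∀ (N₀ : ℕ) [NeZero N₀] (D₀ : ModularParametrizationData W₀ N₀),
              W₀.conductorNorm ℤ ≠ N₀ ∨ (¬ ∀ z ∈ D₀.L.lattice, ∃ w ∈ periodLattice D₀.f, z = D₀.c * w) ∨
              (p : ℤ) ∣ D₀.maninConstant) →
          MissingPPartAt W p) := by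
  constructor
  · intro hX4
    refine ⟨fun W _ _ p _ hp hr hX hs N _ D hN hopt hc ↦ ?_, fun W _ _ p _ hp hr hX hs _ ↦ hX4 W p hp hr hX hs⟩
    exact (missingPPartAt_iff_kimTamagawaDefectAt_of_optimal_of_kimFacts_of_five_le W p hKimk hE67c hGZK
      hmod hp hr hs D hN hopt hc).mp (hX4 W p hp hr hX hs)
  · rintro ⟨hconj, hres⟩ W _ _ p _ hp hr hX hs
    by_cases hD : ∃ (W₀ : WeierstrassCurve ℚ) (_ : W₀.IsElliptic) (_ : W₀.IsGloballyMinimal),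
        IsIsogenous W₀ W ∧ ClassX4 W₀ p ∧ Surj W₀ p ∧
        ∃ (N₀ : ℕ) (_ : NeZero N₀) (D₀ : ModularParametrizationData W₀ N₀),
          W₀.conductorNorm ℤ = N₀ ∧ (∀ z ∈ D₀.L.lattice, ∃ w ∈ periodLattice D₀.f, z = D₀.c * w) ∧
          ¬ (p : ℤ) ∣ D₀.maninConstant
    · obtain ⟨W₀, _, _, hiso, hX₀, hs₀, N₀, _, D₀, hN₀, hopt₀, hc₀⟩ := hD
      have hr₀ : W₀.analyticRank = 0 := by rw [analyticRank_eq_of_isIsogenous' hiso, hr]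
      have hr₀' : W₀.analyticRank ≤ 1 := by rw [hr₀]; exact zero_le_one
      have hr1 : W.analyticRank ≤ 1 := by rw [hr]; exact zero_le_one
      haveI : Finite W.sha := (hGZK W hr1).2
      have hB₀ : BSDp W₀ p :=
        (bsdp_iff_kimTamagawaDefectAt_of_optimal_of_kimFacts_of_five_le W₀ p hKimk hE67c hGZK hmod hp
          hr₀ hs₀ D₀ hN₀ hopt₀ hc₀).mpr (hconj W₀ p hp hr₀ hX₀ hs₀ D₀ hN₀ hopt₀ hc₀)
      exact missingPPartAt_of_bsdp W p
        (Additive.TwistComparison.bsdp_of_bsdp_of_isIsogenous W₀ W p hCassels hGZK hmod hiso hr₀' hB₀)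
    · refine hres W p hp hr hX hs fun W₀ _ _ hiso hX₀ hs₀ N₀ _ D₀ ↦ ?_
      by_contra hnot
      simp only [not_or, not_not] at hnot
      exact hD ⟨W₀, inferInstance, inferInstance, hiso, hX₀, hs₀, N₀, inferInstance, D₀, hnot.1,
        hnot.2.1, hnot.2.2⟩

end Summit.BirchSwinnertonDyer.Rank1Residual.X4

end
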